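import Mathlib
import Summits.ValiantsHypothesis.ValiantsHypothesis.Theses.FeketeSOS

/-!
# Sketch — crux `FeketeSOS.SublinearShadow` (stmt-ValiantsHypothesis-14990), crux-ideate round 1, ideator 2

First lemmas of the two idea cards of this seat (statements only; proofs are for the crux-plan / provers):

* card `window-dft-debordering` — §A: the equal-characteristic WINDOW.  Below `p`-adic order one the truncated
  valuation ring `O_L/p ≅ k[Π]/(Π^e)` is a carry-free `k`-algebra, so a representation of `π`-depth `v < e` is a
  border representation of order `v` over `k[Π]`; the `Π^v`-layer is extracted by a discrete Fourier transform over
  `m`-th roots of unity of `k` (Bini / BCS Prop. 15.26), giving `F̄_p` as `≤ (2v+1)·s` weighted squares of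
  polynomials supported INSIDE the original supports.
* card `witt-carry-obstruction` — §B: PAST the window (`p`-adic depth `≥ 1`, unramified model) the first deep
  layer is `F̄_p^{(p)} = Ω + (cheap)`, `Ω` = first Witt coordinate of the Teichmüller lift of the top-layer null
  relation (its obstruction class to lifting to `W₂(k)`), and `Ω` vanishes at every monomial where the null
  relation cancels in pairs.
-/

set_option linter.dupNamespace false

namespace Summit.ValiantsHypothesis.ValiantsHypothesis.Cruxes.SublinearShadow.Ideator2

open scoped BigOperators Polynomial
open Polynomial Finset

noncomputable section

/-! ## §A  The window: DFT de-bordering over `K[X][Π]` -/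

/-- `X`-support of a two-variable polynomial `Y ∈ K[X][Π]` (outer variable `Π`, coefficients in `K[X]`):
the union of the supports of its `Π`-digits. -/
def suppX {K : Type*} [Semiring K] (Y : Polynomial (Polynomial K)) : Finset ℕ :=
  Y.support.biUnion fun n => (Y.coeff n).support

/-- **Digits stay on the support.**  Evaluating `Y ∈ K[X][Π]` at a constant `Π = a` gives a polynomial in `X`
supported inside `suppX Y`. [folklore] -/
theorem support_eval_C_subset {K : Type*} [Field K] (Y : Polynomial (Polynomial K)) (a : K) :
    (Y.eval (C a)).support ⊆ suppX Y := by
  sorry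

/-- **Window DFT de-bordering (first lemma of card `window-dft-debordering`).**
Let `K` be a field, `ζ ∈ K` a primitive `m`-th root of unity with `2v < m` and `(m : K) ≠ 0`.  Suppose weights
`c_i ∈ K[Π]` and two-variable polynomials `Y_i ∈ K[X][Π]`, all of `Π`-degree `≤ v` (truncated digit
expansions), have `Π^v`-LAYER
`[Π^v] (Σ_i c_i(Π) · Y_i(Π,X)²) = u₀ · F` (`u₀ ≠ 0`; the lower layers are irrelevant for the extraction —
in the application they vanish: a border representation of `F` of order `v`).  Then `F` is an honest weighted sum of `m · s` squares of the
specialisations `Y_i(ζ^k, X)`, each supported inside `suppX (Y i)`: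
`F = Σ_{k<m} Σ_i (u₀ m)⁻¹ ζ^{-kv} c_i(ζ^k) · Y_i(ζ^k, X)²`.
(BCS, Algebraic Complexity Theory, (15.7) and Prop. (15.26): exact algorithms from approximate ones, Bini 1980;
here `ε ↦ Π` = uniformizer digit variable of `O_L/p ≅ k[Π]/(Π^e)`, rank ↦ sparse support.) -/
theorem window_dft_debordering
    (K : Type) [Field K] (s v m : ℕ) (ζ : K) (hζ : IsPrimitiveRoot ζ m) (hm : 2 * v < m) (hmK : (m : K) ≠ 0)
    (c : Fin s → Polynomial K) (Y : Fin s → Polynomial (Polynomial K))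
    (hc : ∀ i, (c i).natDegree ≤ v) (hY : ∀ i, (Y i).natDegree ≤ v)
    (F : Polynomial K) (u₀ : K) (hu : u₀ ≠ 0)
    (h : (∑ i, (c i).map (Polynomial.C : K →+* Polynomial K) * Y i ^ 2).coeff v = Polynomial.C u₀ * F) :
    F = ∑ k ∈ range m, ∑ i,
          Polynomial.C ((u₀ * (m : K))⁻¹ * (ζ ^ k)⁻¹ ^ v * (c i).eval (ζ ^ k)) * ((Y i).eval (C (ζ ^ k))) ^ 2 := by
  sorry

/-- The crux-shaped corollary of §A: a border representation of order `v` with `X`-supports inside given sets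
`S_i` yields an EXACT char-`p` representation with `d ≤ (2v+2)·s` squares supported inside the `S_i`.
(`K` algebraically closed of characteristic `p`: an `m` coprime to `p` with `2v < m ≤ 2v+2` exists and
`K` has a primitive `m`-th root of unity.) -/
theorem shadow_of_window
    (p : ℕ) [Fact p.Prime] (K : Type) [Field K] [CharP K p] [IsAlgClosed K] (s v : ℕ)
    (S : Fin s → Finset ℕ) (c : Fin s → Polynomial K) (Y : Fin s → Polynomial (Polynomial K))
    (hc : ∀ i, (c i).natDegree ≤ v) (hY : ∀ i, (Y i).natDegree ≤ v) (hS : ∀ i, suppX (Y i) ⊆ S i)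
    (F : Polynomial K) (u₀ : K) (hu : u₀ ≠ 0)
    (h : (∑ i, (c i).map (Polynomial.C : K →+* Polynomial K) * Y i ^ 2).coeff v = Polynomial.C u₀ * F) :
    ∃ (d : ℕ) (c' : Fin d → K) (g' : Fin d → Polynomial K),
      d ≤ (2 * v + 2) * s ∧ (∀ j, ∃ i, (g' j).support ⊆ S i) ∧
      (∑ j, (g' j).support.card) ≤ (2 * v + 2) * ∑ i, (S i).card ∧
      (∑ j, Polynomial.C (c' j) * g' j ^ 2) = F := by
  sorry

/-- **Window model of order `v`** for a complex representation `(c, g)` of `F_p`: a field `K` of characteristic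
`p`, weights `γ_i ∈ K[Π]` and digit expansions `Y_i ∈ K[X][Π]` of `Π`-degree `≤ v` with `X`-supports inside
`supp g_i`, representing `Π^v · F̄_p` layer by layer up to order `v`.  Depth `0` at some place (good reduction,
item `DepthZeroShadow`) is a window model of order `0`; an algebraic model over a `p`-adic field `L` whose
`π_L`-adic depth `v` is `< e(L/ℚ_p)` gives one of order `v` (Serre, Local Fields II §5 Thm 4:
`O_L/p ≅ k[Π]/(Π^e)` as `k`-algebras — the carry-free window).  DEEP representations (depth `≥ e` in every
model) have none. -/
def HasWindowModel (p : ℕ) [Fact p.Prime] (s v : ℕ) (g : Fin s → Polynomial ℂ) : Prop :=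
  ∃ (K : Type) (_ : Field K) (_ : CharP K p) (_ : IsAlgClosed K)
    (γ : Fin s → Polynomial K) (Y : Fin s → Polynomial (Polynomial K)) (u₀ : K),
    u₀ ≠ 0 ∧ (∀ i, (γ i).natDegree ≤ v) ∧ (∀ i, (Y i).natDegree ≤ v) ∧
    (∀ i, suppX (Y i) ⊆ (g i).support) ∧
    ∀ n, n ≤ v →
      (∑ i, (γ i).map (Polynomial.C : K →+* Polynomial K) * Y i ^ 2).coeff n
        = if n = v then Polynomial.C u₀ * ∑ m ∈ range p, Polynomial.C ((legendreSym p m : ℤ) : K) * X ^ m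
          else 0

/-- **ORDER BUDGET** — the open core left by card `window-dft-debordering`: every sublinear complex
representation of `F_p` has a window model of order polynomial in the number of squares. -/
def OrderBudget : Prop :=
  ∃ B p₁ : ℕ, ∀ (p : ℕ) [Fact p.Prime], p₁ ≤ p → ∀ (s : ℕ) (c : Fin s → ℂ) (g : Fin s → Polynomial ℂ),
    (∀ i, (g i).natDegree ≤ p ^ 2) → (∑ i, (g i).support.card) ^ 4 ≤ p ^ 3 →
    (∑ i, Polynomial.C (c i) * g i ^ 2) = ∑ m ∈ range p, Polynomial.C ((legendreSym p m : ℤ) : ℂ) * X ^ m →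
    ∃ v, 2 * v + 2 ≤ (s + 1) ^ B ∧ HasWindowModel p s v g

/-- Composition (the line card's skeleton will prove this from `shadow_of_window` + folding exponents mod `p`):
the window lever reduces the crux to the order budget. -/
theorem sublinearShadow_of_orderBudget :
    OrderBudget → Summit.ValiantsHypothesis.ValiantsHypothesis.Theses.FeketeSOS.SublinearShadow := by
  sorry

/-! ## §B  Past the window: the Teichmüller carry (first lemmas of card `witt-carry-obstruction`) -/

variable (p : ℕ) [Fact p.Prime]

local notation "𝕎" => WittVector p

/-- Coefficientwise Teichmüller lift of a polynomial over `k` to a polynomial over `𝕎 k`. -/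
def teichLift {k : Type*} [CommRing k] (a : Polynomial k) : Polynomial (𝕎 k) :=
  ∑ n ∈ a.support, Polynomial.C (WittVector.teichmuller p (a.coeff n)) * X ^ n

/-- The **Teichmüller carry** of a configuration `(C̄_i, Ḡ_i)_{i<s}` over `k`: the polynomial whose `m`-th
coefficient is the FIRST Witt coordinate of the `m`-th coefficient of `Σ_i [C̄_i] · (teichLift Ḡ_i)²`
(degree bound `N`).  When `Σ_i C̄_i Ḡ_i² = 0` (a null relation) the zeroth coordinates vanish and this is the
obstruction class to lifting the null relation from `k` to `W₂(k)` on the same supports (Serre, Local Fields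
II §6: `S₁(a,b) = a₁ + b₁ + (a₀^p + b₀^p − (a₀+b₀)^p)/p`). -/
def teichCarry {k : Type*} [CommRing k] (s N : ℕ) (Cb : Fin s → k) (Gb : Fin s → Polynomial k) : Polynomial k :=
  ∑ m ∈ range (N + 1),
    Polynomial.C (((∑ i, Polynomial.C (WittVector.teichmuller p (Cb i)) * teichLift p (Gb i) ^ 2).coeff m).coeff 1)
      * X ^ m

/-- **Deep-layer formula** (depth exactly one, unramified model).  Over `𝕎 k` (`k` perfect of characteristic
`p`), if `Σ_i C_i G_i² = p · F` in `(𝕎 k)[X]`, then the reduction of `F`, Frobenius-twisted coefficientwise,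
equals the Teichmüller carry of the reduced (null) top layer PLUS a cheap part: `s` weighted squares and `s`
products `Ḡ_i^{(p)} · E_i` with `supp E_i ⊆ supp G_i`.  So `F̄ − Ω` costs `≤ 3s` squares on the same supports,
and the deep case of the crux is exactly the question whether `Ω` is cheap. -/
theorem deep_layer_formula
    (k : Type) [Field k] [CharP k p] [PerfectRing k p]
    (s : ℕ) (Cw : Fin s → 𝕎 k) (G : Fin s → Polynomial (𝕎 k)) (F : Polynomial (𝕎 k))
    (h : ∑ i, Polynomial.C (Cw i) * G i ^ 2 = Polynomial.C (p : 𝕎 k) * F) :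
    ∃ (a b : Fin s → k) (E : Fin s → Polynomial k),
      (∀ i, (E i).support ⊆ (G i).support) ∧
      (F.map (WittVector.constantCoeff : 𝕎 k →+* k)).map (frobenius k p)
        = teichCarry p s (2 * (univ.sup fun i => (G i).natDegree))
            (fun i => WittVector.constantCoeff (Cw i))
            (fun i => (G i).map (WittVector.constantCoeff : 𝕎 k →+* k))
          + ∑ i, (Polynomial.C (a i) * (((G i).map (WittVector.constantCoeff : 𝕎 k →+* k)).map (frobenius k p)) ^ 2
                  + Polynomial.C (b i) * ((G i).map (WittVector.constantCoeff : 𝕎 k →+* k)).map (frobenius k p)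
                      * E i) := by
  sorry

/-- **Pairwise cancellation carries nothing.**  At a monomial `m` where the summands
`C̄_i Ḡ_i(a) Ḡ_i(b)` (`a + b = m`, ordered pairs) of a configuration can be matched in pairs `{x, −x}`
(in particular wherever at most two summands meet in a null relation, `p` odd), the Teichmüller carry vanishes:
`[x] + [−x] = 0` in `𝕎 k`.  Hence `Ω` is supported on the set `T₃` of monomials where `≥ 3` essentially
different products cancel. Typed here in the simplest instance: two proportional squares `Ḡ₂ = μ Ḡ₁`,
`C̄₁ + C̄₂ μ² = 0`. -/
theorem teichCarry_pair_eq_zero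
    (k : Type) [Field k] [CharP k p] (hp : p ≠ 2) (N : ℕ) (G₁ : Polynomial k) (μ C₁ C₂ : k)
    (hnull : C₁ + C₂ * μ ^ 2 = 0) :
    teichCarry p 2 N ![C₁, C₂] ![G₁, Polynomial.C μ * G₁] = 0 := by
  sorry

/-- A configuration WITH a carry (sanity target for the provers; `p` odd, non-Wieferich behaviour is generic):
the null relation `(X^u + X^w)² − 2·(X^{(u+w)/2})²·X^0… ` — typed as the four-square null relation
`(X^u + X^w)² + (i X^u)² + (i X^w)² + (√(-2) X^{(u+w)/2})² = 0` (`u + w` even, `u ≠ w`) — has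
`Ω = ((2 − 2^p)/p) · X^{u+w}` up to the Frobenius twist: three summands `1, 1, −2` meet at `X^{u+w}`.
Recorded as a `Prop` (the exact constant is for the prover to pin). -/
def ThreefoldCollisionCarry : Prop :=
  ∀ (k : Type) [Field k] [CharP k p] [IsAlgClosed k] (u w : ℕ), u < w → Even (u + w) →
    ∀ (i r : k), i ^ 2 = -1 → r ^ 2 = -2 →
      (teichCarry p 4 (2 * w) ![1, 1, 1, 1]
        ![X ^ u + X ^ w, Polynomial.C i * X ^ u, Polynomial.C i * X ^ w, Polynomial.C r * X ^ ((u + w) / 2)]).support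
        ⊆ {u + w}

end

end Summit.ValiantsHypothesis.ValiantsHypothesis.Cruxes.SublinearShadow.Ideator2
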